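import Summits.AnomalousDissipation.AnomalousDissipation.Theses.MomentParity
import Summits.AnomalousDissipation.AnomalousDissipation.Theorems.QuarticGate.Negative.EnergyRow
import Summits.AnomalousDissipation.AnomalousDissipation.Theorems.CubicParityLoud.Negative.EnergyRow
import Summits.AnomalousDissipation.AnomalousDissipation.Theorems.CubicParityLoud.Negative.FluxFloor
import Summits.AnomalousDissipation.AnomalousDissipation.Theorems.ResolvedDissipation.Negative.KillShape
import Summits.AnomalousDissipation.AnomalousDissipation.Theorems.MomentParityResolvedDissipationStubSchedule
import Literature.Analysis.FluidPDE.StatisticalSolutionEnergyEq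
import Literature.Analysis.FluidPDE.StatisticalSolutionProofs
import Literature.Analysis.FunctionSpaces.TorusTrigPoly

/-!
# Route MomentParity · crux `ResolvedDissipation` (stmt-AnomalousDissipation-14284) —
# line `lions-l4-domination` (skeleton v4): resolution ⟺ uniform decay of the mean energy flux

Supports stmt-AnomalousDissipation-14284 (helper of the line lead; no route-item statement is asserted).

Fix a smooth force `f`, a viscosity `ν > 0` and a radius `R`. Call a law `μ` on `H = L²_σ(T³)`
ADMISSIBLE at level `N` if it is a probability measure carried by level-`N` Fourier–Galerkin fields
(`IsLevel N` a.e.), supported in the ball `‖u‖ ≤ R`, and stationary at every polynomial order for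
Galerkin NS at `(ν, f)` (`∀ d, IsPolyStationary ν f N d μ`). The main theorem
`resolvedAt_iff_uniformFluxDecay` is the crux AT FIXED `(f, ν, R)` written in FLUX CURRENCY:

  (∃ one schedule `κ` with `∫‖∇u‖² dμ ≤ ∫‖∇P_{κ n}u‖² dμ + 1/(n+1)` for every admissible `μ`, every `N`, `n`)
  ⟺ (the MEAN SPECTRAL ENERGY FLUX `E_μ Π_m`, `Π_m(u) = ∫ (u ⊗ u) : ∇P_m u = inertialPairing u (P_m u)`,
     tends to `0` as `m → ∞` UNIFORMLY over all admissible `(N, μ)`).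

Proof (folklore bookkeeping around the HIGH-MODE ENERGY ROW). For an admissible `μ` at level `N` and
any cutoff `m`, the quadratic observable `½ Σ_{e ∈ frame(m)} (u, e)²` over the Galerkin frame of level `m`
is an admissible test (its fields are level-`N` band tests when `m ≤ N`; when `m > N` its row coincides
a.e. with the level-`N` energy row), its differential is `P_m u`, and its row reads
`E_μ[(u, P_m f) − ν‖∇P_m u‖² + Π_m] = 0` (`CubicParityLoud.Negative.nsGeneratorPairing_energy_eq_flux`);
the energy row itself is `ν E_μ‖∇u‖² = E_μ(u, f)` (`ensembleDissipation_eq_of_polyStationary`). Subtracting,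
`ν E_μ[‖∇u‖² − ‖∇P_m u‖²] + E_μ Π_m = E_μ (u, f − P_m f)`, and `|E_μ(u, f − P_m f)| ≤ R ‖f − P_m f‖₂ → 0`
uniformly over admissible laws (Cauchy–Schwarz; Parseval tail of `f`). Hence the enstrophy tails
`E_μ[‖∇u‖² − ‖∇P_m u‖²] ≥ 0` decay uniformly iff the mean fluxes do; and uniform tail decay is the
schedule statement (tails are monotone in the cutoff, `eGradNormSq_fourierTruncate_mono`).
-/

noncomputable section

-- `Summit.<Summit>.<Problem>`: single-conjunct summit, the duplicate namespace segment is mandated.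
set_option linter.dupNamespace false

namespace Summit.AnomalousDissipation.AnomalousDissipation.Theorems.MomentParityResolvedDissipation.FluxDecay

open MeasureTheory Filter Topology
open scoped ENNReal NNReal InnerProductSpace RealInnerProductSpace
open Literature.Analysis.FunctionSpaces Literature.Analysis.FluidPDE
open Summit.AnomalousDissipation.AnomalousDissipation.Theses.MomentParity
open Summit.AnomalousDissipation.AnomalousDissipation.Theorems.QuarticGate.Negative
open Summit.AnomalousDissipation.AnomalousDissipation.Theorems.CubicParityLoud.Negative
  (T3 R3 H3 L2T3 frameG energyPoly isBandTest_frameG totalDegree_energyPoly integrable_pairing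
    nsGeneratorPairing_energy_of_isLevel nsGeneratorPairing_energy_eq_flux pairing_sub_field
    continuous_lowEnstrophy lowEnstrophy_nonneg lowEnstrophy_le)

/-! ## Elementary helpers -/

/-- `X ≤ Y + ofReal ε ⟺ X.toReal ≤ Y.toReal + ε` for finite `X`, `Y` and `ε ≥ 0`. [folklore] -/
theorem le_add_ofReal_iff {X Y : ℝ≥0∞} (hX : X ≠ ⊤) (hY : Y ≠ ⊤) {ε : ℝ} (hε : 0 ≤ ε) :
    X ≤ Y + ENNReal.ofReal ε ↔ X.toReal ≤ Y.toReal + ε := by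
  rw [← ENNReal.toReal_le_toReal hX (ENNReal.add_ne_top.2 ⟨hY, ENNReal.ofReal_ne_top⟩),
    ENNReal.toReal_add hY ENNReal.ofReal_ne_top, ENNReal.toReal_ofReal hε]

/-- The tolerance `1/(n+1)` of the crux as `ENNReal.ofReal`. [folklore] -/
theorem inv_natCast_succ_eq_ofReal (n : ℕ) :
    ((n : ℝ≥0∞) + 1)⁻¹ = ENNReal.ofReal (1 / ((n : ℝ) + 1)) := by
  rw [one_div, ENNReal.ofReal_inv_of_pos (by positivity), ENNReal.ofReal_add (by positivity) zero_le_one,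
    ENNReal.ofReal_natCast, ENNReal.ofReal_one]

/-- Level-`N` fields are level-`m` fields for `N ≤ m` (`freqBall` is monotone). [folklore] -/
theorem isLevel_mono {N m : ℕ} (h : N ≤ m) {u : H3} (hu : IsLevel N u) : IsLevel m u :=
  fun k hk => hu k fun h' => hk
    (Finset.mem_erase.2 ⟨(Finset.mem_erase.1 h').1, Torus.freqBall_mono h (Finset.mem_erase.1 h').2⟩)

/-- The truncated enstrophy `‖∇P_m u‖²` of `u ∈ H` is finite (a trigonometric polynomial). [folklore] -/
theorem eGradNormSq_fourierTruncate_lt_top (m : ℕ) (u : H3) :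
    Torus.eGradNormSq (Torus.fourierTruncate m ((u.1 : L2T3) : T3 → R3)) < ⊤ := by
  have hint : Integrable ((u.1 : L2T3) : T3 → R3) volume := (Lp.memLp (u.1 : L2T3)).integrable one_le_two
  rw [Torus.fourierTruncate_eq,
    Torus.eGradNormSq_realTrigPoly Torus.neg_mem_freqBall_of_mem (Torus.isConjSymm_mFourierCoeff hint)]
  exact ENNReal.ofReal_lt_top

/-- **Cauchy–Schwarz in the ball**: a probability law on `H` carried by `‖u‖ ≤ R` has
`|∫ (u, g) dμ| ≤ R ‖g‖₂` for every `g ∈ L²`. [folklore] -/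
theorem abs_integral_pairing_le {μ : Measure H3} [IsProbabilityMeasure μ] {R : ℝ}
    (hR : ∀ᵐ u ∂μ, ‖u‖ ≤ R) {g : T3 → R3} (hg : MemLp g 2 volume) :
    |∫ u, Torus.pairing u.1 g ∂μ| ≤ R * (eLpNorm g 2 volume).toReal := by
  have h : ∀ᵐ u ∂μ, ‖Torus.pairing u.1 g‖ ≤ R * (eLpNorm g 2 volume).toReal := hR.mono fun u hu => by
    rw [Real.norm_eq_abs, ← Lp.norm_toLp g hg]
    exact (Torus.abs_pairing_coe_le hg u).trans (mul_le_mul_of_nonneg_right hu (norm_nonneg _))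
  have h2 := norm_integral_le_of_norm_le_const h
  rwa [probReal_univ, mul_one, Real.norm_eq_abs] at h2

/-- **Parseval tail of the force**: `‖f − P_m f‖₂ → 0` for `f ∈ L²`. [folklore] -/
theorem tendsto_eLpNorm_sub_fourierTruncate {f : T3 → R3} (hf : MemLp f 2 volume) :
    Tendsto (fun m => (eLpNorm (f - Torus.fourierTruncate m f) 2 volume).toReal) atTop (𝓝 0) := by
  have h := (ENNReal.tendsto_toReal ENNReal.zero_ne_top).comp (Torus.tendsto_eLpNorm_fourierTruncate_sub hf)
  rw [ENNReal.toReal_zero] at h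
  refine h.congr fun m => ?_
  rw [Function.comp_apply, eLpNorm_sub_comm]

/-! ## The high-mode energy row of an admissible law -/

/-- **The row of the level-`m` energy observable holds at EVERY cutoff.** For a level-`N` law `μ`,
`3`-stationary for Galerkin NS at `(ν, f)`, and any `m`, the row of `Σ_{e ∈ frame(m)} (u, e)²` is
integrable with zero mean: for `m ≤ N` the frame fields of level `m` are level-`N` band tests; for
`N ≤ m` the row integrand coincides `μ`-a.e. with the level-`N` energy row (`P_m u = P_N u = u`).
[folklore] -/
theorem energyRow_frame {ν : ℝ} {f : T3 → R3} {N : ℕ} {μ : Measure H3} (hlev : ∀ᵐ u ∂μ, IsLevel N u)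
    (hstat : IsPolyStationary ν f N 3 μ) (m : ℕ) :
    Integrable (fun u => Torus.nsGeneratorPairing ν f u
        (CubicParityLoud.Negative.polyGrad (frameG m) (energyPoly _) u)) μ ∧
      ∫ u, Torus.nsGeneratorPairing ν f u
        (CubicParityLoud.Negative.polyGrad (frameG m) (energyPoly _) u) ∂μ = 0 := by
  rcases le_total m N with hmN | hNm
  · exact hstat _ (frameG m) (energyPoly _) (fun i => (isBandTest_frameG m i).mono hmN)
      (totalDegree_energyPoly _)
  · obtain ⟨hI, h0⟩ := hstat _ (frameG N) (energyPoly _) (isBandTest_frameG N) (totalDegree_energyPoly _)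
    have hae : (fun u => Torus.nsGeneratorPairing ν f u
        (CubicParityLoud.Negative.polyGrad (frameG N) (energyPoly _) u)) =ᵐ[μ]
        fun u => Torus.nsGeneratorPairing ν f u
          (CubicParityLoud.Negative.polyGrad (frameG m) (energyPoly _) u) := by
      filter_upwards [hlev] with u hu
      rw [nsGeneratorPairing_energy_of_isLevel ν f (N := N) hu,
        nsGeneratorPairing_energy_of_isLevel ν f (N := m) (isLevel_mono hNm hu)]
    exact ⟨hI.congr hae, by rw [← integral_congr_ae hae]; exact h0⟩

/-- **THE HIGH-MODE ENERGY ROW (flux identity).** For a level-`N` probability law `μ` in the ball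
`‖u‖ ≤ R`, `3`-stationary for Galerkin NS at `(ν, f)` with a smooth force `f`, and every cutoff `m`:
the energy flux `Π_m(u) = ∫ (u ⊗ u) : ∇P_m u` is `μ`-integrable and
`ν (E_μ‖∇u‖² − E_μ‖∇P_m u‖²) + E_μ Π_m = E_μ (u, f − P_m f)`
(row of `½ Σ_{frame(m)} (u,e)²`: `E[(u, P_m f) − ν‖∇P_m u‖² + Π_m] = 0`, minus the energy row
`ν E‖∇u‖² = E(u, f)`). [folklore] -/
theorem flux_identity {ν : ℝ} {f : T3 → R3} (hf : Torus.IsSmooth f) {N : ℕ} {μ : Measure H3}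
    [IsProbabilityMeasure μ] (hlev : ∀ᵐ u ∂μ, IsLevel N u) {R : ℝ} (hR : ∀ᵐ u ∂μ, ‖u‖ ≤ R)
    (hstat : IsPolyStationary ν f N 3 μ) (m : ℕ) :
    Integrable (fun u : H3 => Torus.inertialPairing u.1
        (Torus.fourierTruncate m (u.1 : T3 → R3))) μ ∧
      ν * ((∫⁻ u, Torus.eGradNormSq (u.1 : T3 → R3) ∂μ).toReal -
            (∫⁻ u, Torus.eGradNormSq (Torus.fourierTruncate m (u.1 : T3 → R3)) ∂μ).toReal) +
          ∫ u, Torus.inertialPairing u.1 (Torus.fourierTruncate m (u.1 : T3 → R3)) ∂μ =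
        ∫ u, Torus.pairing u.1 (f - Torus.fourierTruncate m f) ∂μ := by
  have hfL2 : MemLp f 2 volume := hf.memLp 2
  have h1 : Integrable (fun u : H3 => ‖u‖) μ :=
    Integrable.of_bound continuous_norm.aestronglyMeasurable R (hR.mono fun u hu => by simpa using hu)
  have h2 : Integrable (fun u : H3 => ‖u‖ ^ 2) μ :=
    Integrable.of_bound (continuous_norm.pow 2).aestronglyMeasurable (R ^ 2) (hR.mono fun u hu => by
      rw [Real.norm_eq_abs, abs_of_nonneg (by positivity)]
      exact pow_le_pow_left₀ (norm_nonneg _) hu 2)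
  -- the row of the level-`m` energy observable
  obtain ⟨hI, h0⟩ := energyRow_frame hlev hstat m
  set G : H3 → ℝ := fun u => Torus.nsGeneratorPairing ν f u
    (CubicParityLoud.Negative.polyGrad (frameG m) (energyPoly _) u) with hG
  set A : H3 → ℝ := fun u => Torus.pairing u.1 (Torus.fourierTruncate m f) with hA
  set L : H3 → ℝ := fun u =>
    (Torus.eGradNormSq (Torus.fourierTruncate m ((u : L2T3) : T3 → R3))).toReal with hL
  set Φ : H3 → ℝ := fun u =>
    Torus.inertialPairing (u : L2T3) (Torus.fourierTruncate m ((u : L2T3) : T3 → R3)) with hΦ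
  have hGeq : ∀ u, G u = 2 * (A u - ν * L u - (-Φ u)) := fun u =>
    nsGeneratorPairing_energy_eq_flux ν hfL2 m u
  have hAint : Integrable A μ := integrable_pairing (Torus.memLp_fourierTruncate m f 2) h1
  have hLint : Integrable L μ := by
    refine Integrable.mono' (h2.const_mul (4 * Real.pi ^ 2 * (m : ℝ) ^ 2))
      (continuous_lowEnstrophy m).aestronglyMeasurable (ae_of_all _ fun u => ?_)
    rw [Real.norm_eq_abs, abs_of_nonneg (lowEnstrophy_nonneg m u)]
    exact lowEnstrophy_le m u
  have hΦeq : ∀ u, Φ u = 2⁻¹ * G u - (A u - ν * L u) := by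
    intro u; rw [hGeq u]; ring
  have hI1 : Integrable (fun u => A u - ν * L u) μ := hAint.sub (hLint.const_mul ν)
  have hI2 : Integrable (fun u => 2⁻¹ * G u) μ := hI.const_mul _
  have hΦint : Integrable Φ μ := (hI2.sub hI1).congr (ae_of_all _ fun u => (hΦeq u).symm)
  have hΦI : ∫ u, Φ u ∂μ = ν * ∫ u, L u ∂μ - ∫ u, A u ∂μ := by
    rw [integral_congr_ae (ae_of_all μ hΦeq), integral_sub hI2 hI1, integral_const_mul, h0,
      integral_sub hAint (hLint.const_mul ν), integral_const_mul]
    ring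
  -- the truncated mean enstrophy as a Bochner integral
  have hLI : ∫ u, L u ∂μ =
      (∫⁻ u, Torus.eGradNormSq (Torus.fourierTruncate m (u.1 : T3 → R3)) ∂μ).toReal :=
    integral_toReal (Schedule.measurable_eGradNormSq_fourierTruncate m).aemeasurable
      (ae_of_all _ fun u => eGradNormSq_fourierTruncate_lt_top m u)
  -- the energy row at level `N`
  have hrow := ensembleDissipation_eq_of_polyStationary f hfL2 hlev h2 le_rfl hstat
  unfold Torus.ensembleDissipation Torus.ensembleEnstrophy at hrow
  -- the pairing with the force splits
  have hsplit : ∫ u, Torus.pairing u.1 (f - Torus.fourierTruncate m f) ∂μ =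
      (∫ u, Torus.pairing u.1 f ∂μ) - ∫ u, A u ∂μ := by
    rw [← integral_sub (integrable_pairing hfL2 h1) hAint]
    exact integral_congr_ae (ae_of_all _ fun u =>
      pairing_sub_field u hf.continuous (Torus.continuous_fourierTruncate m f))
  refine ⟨hΦint, ?_⟩
  rw [hsplit, ← hrow, hΦI, hLI]
  ring

/-- **The flux–tail estimate of an admissible law.** Under the hypotheses of `flux_identity`, for
every cutoff `m`: the mean enstrophy is finite, the truncated mean enstrophy is below it, and
`|ν (E_μ‖∇u‖² − E_μ‖∇P_m u‖²) + E_μ Π_m| ≤ R ‖f − P_m f‖₂`. [folklore] -/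
theorem flux_tail_estimate {ν : ℝ} {f : T3 → R3} (hf : Torus.IsSmooth f) {N : ℕ} {μ : Measure H3}
    [IsProbabilityMeasure μ] (hlev : ∀ᵐ u ∂μ, IsLevel N u) {R : ℝ} (hR : ∀ᵐ u ∂μ, ‖u‖ ≤ R)
    (hstat : IsPolyStationary ν f N 3 μ) (m : ℕ) :
    ∫⁻ u, Torus.eGradNormSq (u.1 : T3 → R3) ∂μ ≠ ⊤ ∧
      ∫⁻ u, Torus.eGradNormSq (Torus.fourierTruncate m (u.1 : T3 → R3)) ∂μ ≤
          ∫⁻ u, Torus.eGradNormSq (u.1 : T3 → R3) ∂μ ∧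
        |ν * ((∫⁻ u, Torus.eGradNormSq (u.1 : T3 → R3) ∂μ).toReal -
              (∫⁻ u, Torus.eGradNormSq (Torus.fourierTruncate m (u.1 : T3 → R3)) ∂μ).toReal) +
            ∫ u, Torus.inertialPairing u.1 (Torus.fourierTruncate m (u.1 : T3 → R3)) ∂μ| ≤
          R * (eLpNorm (f - Torus.fourierTruncate m f) 2 volume).toReal := by
  refine ⟨Theorems.ResolvedDissipation.Negative.ensembleEnstrophy_ne_top hlev hR,
    lintegral_mono fun u => Torus.eGradNormSq_fourierTruncate_le
      ((Lp.memLp (u.1 : L2T3)).integrable one_le_two) m, ?_⟩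
  rw [(flux_identity hf hlev hR hstat m).2]
  exact abs_integral_pairing_le hR ((hf.memLp 2).sub (Torus.memLp_fourierTruncate m f 2))

/-! ## Resolution ⟺ uniform decay of the mean energy flux -/

/-- **Resolution at `(f, ν, R)` ⟺ uniform decay of the mean spectral energy flux.** For a smooth force
`f`, `ν > 0` and a radius `R`: ONE schedule `κ` resolves the mean enstrophy of every admissible law
(probability, level-`N` carried, supported in `‖u‖ ≤ R`, stationary at every polynomial order for Galerkin
NS at `(ν, f)`) at every level `N` — `∫‖∇u‖² dμ ≤ ∫‖∇P_{κ n}u‖² dμ + 1/(n+1)` — if and only if the mean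
energy flux `E_μ Π_m`, `Π_m(u) = ∫ (u ⊗ u) : ∇P_m u`, tends to zero as `m → ∞` uniformly over all
admissible `(N, μ)`. Both directions go through the high-mode energy row
`ν E_μ[‖∇u‖² − ‖∇P_m u‖²] + E_μ Π_m = E_μ(u, f − P_m f)`, `|E_μ(u, f − P_m f)| ≤ R‖f − P_m f‖₂ → 0`
(`flux_tail_estimate`), and the monotonicity of the enstrophy tails in the cutoff. [folklore] -/
theorem resolvedAt_iff_uniformFluxDecay :
    ∀ (f : UnitAddTorus (Fin 3) → EuclideanSpace ℝ (Fin 3)) (ν R : ℝ), Torus.IsSmooth f → 0 < ν →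
    ((∃ κ : ℕ → ℕ, ∀ (N : ℕ) (μ : Measure (Torus.energySpace (Fin 3))), IsProbabilityMeasure μ →
        (∀ᵐ u ∂μ, IsLevel N u) → (∀ᵐ u ∂μ, ‖u‖ ≤ R) → (∀ d : ℕ, IsPolyStationary ν f N d μ) →
        ∀ n : ℕ, ∫⁻ u, Torus.eGradNormSq (u.1 : UnitAddTorus (Fin 3) → EuclideanSpace ℝ (Fin 3)) ∂μ ≤
          (∫⁻ u, Torus.eGradNormSq (Torus.fourierTruncate (κ n)
            (u.1 : UnitAddTorus (Fin 3) → EuclideanSpace ℝ (Fin 3))) ∂μ) + ((n : ℝ≥0∞) + 1)⁻¹) ↔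
     (∀ ε : ℝ, 0 < ε → ∃ m₀ : ℕ, ∀ m : ℕ, m₀ ≤ m →
        ∀ (N : ℕ) (μ : Measure (Torus.energySpace (Fin 3))), IsProbabilityMeasure μ →
        (∀ᵐ u ∂μ, IsLevel N u) → (∀ᵐ u ∂μ, ‖u‖ ≤ R) → (∀ d : ℕ, IsPolyStationary ν f N d μ) →
        |∫ u, Torus.inertialPairing u.1 (Torus.fourierTruncate m
            (u.1 : UnitAddTorus (Fin 3) → EuclideanSpace ℝ (Fin 3))) ∂μ| ≤ ε)) := by
  intro f ν R hf hν
  have hfL2 : MemLp f 2 volume := hf.memLp 2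
  -- the force tail, weighted by the radius, decays
  have hδ : Tendsto (fun m => R * (eLpNorm (f - Torus.fourierTruncate m f) 2 volume).toReal)
      atTop (𝓝 0) := by
    simpa using (tendsto_eLpNorm_sub_fourierTruncate hfL2).const_mul R
  constructor
  · -- resolved ⟹ uniform flux decay
    rintro ⟨κ, hκ⟩ ε hε
    have hε2 : (0 : ℝ) < ε / 2 := by positivity
    obtain ⟨m₁, hm₁⟩ := eventually_atTop.1 (hδ.eventually_le_const hε2)
    obtain ⟨n, hn⟩ := exists_nat_one_div_lt (show (0 : ℝ) < ε / (2 * ν) by positivity)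
    refine ⟨max (κ n) m₁, fun m hm N μ hp hl hb hs => ?_⟩
    haveI := hp
    obtain ⟨hX, hYX, hest⟩ := flux_tail_estimate hf hl hb (hs 3) m
    have hY : ∫⁻ u, Torus.eGradNormSq (Torus.fourierTruncate m
        (u.1 : UnitAddTorus (Fin 3) → EuclideanSpace ℝ (Fin 3))) ∂μ ≠ ⊤ := ne_top_of_le_ne_top hX hYX
    -- the schedule bounds the tail at cutoff `m ≥ κ n` by `1/(n+1)`
    have htail : (∫⁻ u, Torus.eGradNormSq (u.1 : UnitAddTorus (Fin 3) → EuclideanSpace ℝ (Fin 3)) ∂μ).toReal ≤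
        (∫⁻ u, Torus.eGradNormSq (Torus.fourierTruncate m
          (u.1 : UnitAddTorus (Fin 3) → EuclideanSpace ℝ (Fin 3))) ∂μ).toReal + 1 / ((n : ℝ) + 1) := by
      refine (le_add_ofReal_iff hX hY (by positivity)).1 ?_
      rw [← inv_natCast_succ_eq_ofReal]
      refine (hκ N μ hp hl hb hs n).trans (add_le_add (lintegral_mono fun u => ?_) le_rfl)
      exact Theorems.ResolvedDissipation.Negative.eGradNormSq_fourierTruncate_mono (le_of_max_le_left hm)
        ((Lp.memLp u.1).integrable one_le_two)
    have h0 : (∫⁻ u, Torus.eGradNormSq (Torus.fourierTruncate m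
          (u.1 : UnitAddTorus (Fin 3) → EuclideanSpace ℝ (Fin 3))) ∂μ).toReal ≤
        (∫⁻ u, Torus.eGradNormSq (u.1 : UnitAddTorus (Fin 3) → EuclideanSpace ℝ (Fin 3)) ∂μ).toReal :=
      ENNReal.toReal_mono hX hYX
    have hRδ := hm₁ m (le_of_max_le_right hm)
    have hνn : ν * (1 / ((n : ℝ) + 1)) ≤ ε / 2 := by
      calc ν * (1 / ((n : ℝ) + 1)) ≤ ν * (ε / (2 * ν)) := mul_le_mul_of_nonneg_left hn.le hν.le
        _ = ε / 2 := by field_simp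
    rw [abs_le] at hest ⊢
    constructor <;> nlinarith [mul_le_mul_of_nonneg_left htail hν.le, mul_le_mul_of_nonneg_left h0 hν.le]
  · -- uniform flux decay ⟹ resolved
    intro hflux
    have key : ∀ n : ℕ, ∃ K : ℕ, ∀ (N : ℕ) (μ : Measure (Torus.energySpace (Fin 3))),
        IsProbabilityMeasure μ → (∀ᵐ u ∂μ, IsLevel N u) → (∀ᵐ u ∂μ, ‖u‖ ≤ R) →
        (∀ d : ℕ, IsPolyStationary ν f N d μ) →
        ∫⁻ u, Torus.eGradNormSq (u.1 : UnitAddTorus (Fin 3) → EuclideanSpace ℝ (Fin 3)) ∂μ ≤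
          (∫⁻ u, Torus.eGradNormSq (Torus.fourierTruncate K
            (u.1 : UnitAddTorus (Fin 3) → EuclideanSpace ℝ (Fin 3))) ∂μ) + ((n : ℝ≥0∞) + 1)⁻¹ := by
      intro n
      have hη : (0 : ℝ) < ν / (2 * ((n : ℝ) + 1)) := by positivity
      obtain ⟨m₀, hm₀⟩ := hflux _ hη
      obtain ⟨m₁, hm₁⟩ := eventually_atTop.1 (hδ.eventually_le_const hη)
      refine ⟨max m₀ m₁, fun N μ hp hl hb hs => ?_⟩
      haveI := hp
      obtain ⟨hX, hYX, hest⟩ := flux_tail_estimate hf hl hb (hs 3) (max m₀ m₁)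
      have hY : ∫⁻ u, Torus.eGradNormSq (Torus.fourierTruncate (max m₀ m₁)
          (u.1 : UnitAddTorus (Fin 3) → EuclideanSpace ℝ (Fin 3))) ∂μ ≠ ⊤ := ne_top_of_le_ne_top hX hYX
      have hπ := hm₀ _ (le_max_left m₀ m₁) N μ hp hl hb hs
      have hRδ := hm₁ _ (le_max_right m₀ m₁)
      rw [inv_natCast_succ_eq_ofReal, le_add_ofReal_iff hX hY (by positivity)]
      rw [abs_le] at hest hπ
      have h2 : ν * ((∫⁻ u, Torus.eGradNormSq (u.1 : UnitAddTorus (Fin 3) → EuclideanSpace ℝ (Fin 3)) ∂μ).toReal -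
          (∫⁻ u, Torus.eGradNormSq (Torus.fourierTruncate (max m₀ m₁)
            (u.1 : UnitAddTorus (Fin 3) → EuclideanSpace ℝ (Fin 3))) ∂μ).toReal) ≤
          ν * (1 / ((n : ℝ) + 1)) := by
        have e : ν * (1 / ((n : ℝ) + 1)) = 2 * (ν / (2 * ((n : ℝ) + 1))) := by
          field_simp
        rw [e]
        linarith
      have h3 := le_of_mul_le_mul_left h2 hν
      linarith
    choose κ hκ using key
    exact ⟨κ, fun N μ hp hl hb hs n => hκ n N μ hp hl hb hs⟩

end Summit.AnomalousDissipation.AnomalousDissipation.Theorems.MomentParityResolvedDissipation.FluxDecay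

end
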